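import Summits.QuantumFields.QCD.Theses.QuarksAsStableAction
import Summits.QuantumFields.QCD.Theorems.QuarksAsStableActionUnquenchedChessboardBound
import Summits.QuantumFields.QCD.Theorems.QuarksAsStableActionWilsonQuarkStability
import Summits.QuantumFields.QCD.Theorems.QuarksAsStableActionStableActionBridgeSoftClosureCanonical
import Summits.QuantumFields.QCD.Theorems.QuarksAsStableActionStableActionBridgeStubPermExact
import Summits.QuantumFields.QCD.Theorems.QuarksAsStableActionStableActionBridgeStubOffDiagonalTensorDensity
import Literature.MathematicalPhysics.QuantumFieldTheory.SchwingerLimitInheritance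
import Literature.MathematicalPhysics.QuantumFieldTheory.OSData
import Literature.MathematicalPhysics.QuantumFieldTheory.MassGapFromLatticeClustering
import Literature.MathematicalPhysics.QuantumFieldTheory.QCDOS
import Literature.MathematicalPhysics.QuantumFieldTheory.QCDPhaseQuenched
import Literature.MathematicalPhysics.QuantumFieldTheory.QCDSiteReflectionPositivityProofs
import Literature.MathematicalPhysics.QuantumLattice.GrassmannCoefficientRegularity
import Literature.MathematicalPhysics.QuantumLattice.SchwartzTensor
import Literature.MathematicalPhysics.QuantumLattice.RandomField
import Literature.MathematicalPhysics.AQFT.OSAxiomsSchwinger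
import HarnessLib
import Summits.QuantumFields.QCD.Statement

/-!
# Line `Sketch` for crux `QuarksAsStableAction.StableActionBridge` (item stmt-QuantumFields-9737,
# route route-QuantumFields-QuarksAsStableAction) — lead skeleton, RESHAPE r3d (continuation lead c16, cycle 17, 2026-08-17; r3c by c15)


## r3d (lead c16, cycle 17): two strengthenings registered as worker stubs, P3 read on real tensors, P7 dropped

ALL FIVE support files are LANDED and imported (`Theorems/QuarksAsStableActionStableActionBridgeDefs.lean` p140361 (T0),
`…SoftClosureLimit.lean` p140371, `…SoftClosureQCD.lean` p140674, `…SoftClosureCanonical.lean` p140817; the hermiticity lemma is the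
tree's `YangMills…TwoOrbitSynchronisation.osLegsC_isHermitian_of_isReflectionPositive`) — nothing is inlined any more.  Two clauses of the
r3c package are discharged by registered stubs that were proved and LANDED in wave 1 of this cycle (`…StubPermExact.lean` p141413,
`…StubOffDiagonalTensorDensity.lean` p141569; imported): `stub_permExact` (exact permutation symmetry of
`qcdLatticeDist` at every `k` — the insertions are even, hence central, Grassmann elements; replaces P7) and
`stub_offDiagonalTensorDensity` (pure analysis: off-diagonal REAL TENSOR PRODUCTS are total in `⁰𝒮((ℝ⁴)ⁿ)`, OS 1973 §2), through
the proved ε/3-reduction `tendsto_offDiagonal_of_tensor` / `tendsto_qcdLatticeDist_of_tensor`: with the k-uniform E0′ bound P2, full-sequence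
convergence of the lattice `n`-point functions on `⁰𝒮` (P3) follows from their convergence on off-diagonal real tensors — which is
LITERALLY the convergence datum of the statement's `IsQCDAlong` (`qcdLatticeSchwinger sch k n σ f → 𝔖ₙ^σ(⊗fᵢ)`).  So `LatticePackage` (r3d)
asks of honest lattice QCD only: P1 scaling/branch, P2 k-uniform E0′ bound on `⁰𝒮`, P3′ convergence of `qcdLatticeSchwinger` on off-diagonal
real tensors, P6 asymptotic translation invariance, P8 eventually approximately positive OS forms, P9 k-uniform spatial clustering,
P10 `HasSpeciesCSClustering Δ ∧ HasLatticeMassGap Δ`, P11 three non-vanishing witnesses.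


## Why a reshape

`StableActionBridge := UnquenchedChessboardBound → WilsonQuarkStability → QCD`.  Both hypotheses are theorems of the tree
(A = item 9735, S = item 9736), so the crux is LITERALLY the summit conjunct `QCD = QCDOf 2 ∧ QCDOf 3`
(`stableActionBridge_iff_qcd` below).  The skeleton registered from cycle 8 to cycle 16 cut it along the quark-mass seam
into the two ITEMS `ThresholdQCD` (8794) and `ChiralCompletion := ThresholdQCD-clause → QCDOf` (17394), glued by modus
ponens — a split the route re-audit of 2026-08-17T01:51Z (docs/m5/EXEMPT46-REEXAM-2026-08-17.md, row 36) rightly bins as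
**TRIVIAL-SEAM** ("the summit cut along the quark-mass seam with nothing proved between the pieces"; fix asked: "pieces that
are statements in their own right … from which QCDOf follows through a PROVED limiting/continuation argument").

This reshape supplies exactly that proved limiting argument.  The crux is re-cut along the LATTICE / CONTINUUM seam of the
Osterwalder–Schrader framework, where real mathematics lives between the pieces:

* `stub_latticeQCD : ∀ N_f ∈ {2,3}, LatticePackage N_f` — the HONEST LATTICE-SIDE PACKAGE (open problem; a statement about
  Wilson's lattice QCD alone — no OS data, no Euclidean invariance, no packaging): one mass-independent regularisation with
  leading-log mass scaling and chiral gaplessness such that at every positive mass tuple the CANONICAL lattice `n`-point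
  DISTRIBUTIONS `qcdLatticeDist (reg.scheme m z shift) k n σ` (r3c; continuous linear functionals on `𝓢((ℝ⁴)ⁿ)` which ARE
  `qcdLatticeSchwinger` on real tensors — `qcdLatticeSchwinger_eq_qcdLatticeDist`, proved) obey a k-uniform E0′ bound and
  converge on `⁰𝒮`, are asymptotically translation invariant / permutation symmetric (normalisation is a theorem,
  `qcdLatticeDist_zero_apply`; hermiticity follows from normalisation + positivity), have eventually approximately positive OS forms, cluster uniformly in space, cluster à la
  Cauchy–Schwarz in time at a rate `Δ > 0` at which the scheme also has the uniform lattice gap, and have non-vanishing glue /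
  flavour-changing-pseudoscalar two-point functions and glue `κ₃` (clause-by-clause docstring on `LatticePackage`);
* `stub_rotation : ∀ N_f ∈ {2,3}, RotationModule N_f` — the E1 MODULE (open problem; = item stmt-QuantumFields-8840
  `RotationRestoration` of routes FourMirrorsWardE1 / DiagonalSpine / GapBuysCauchyRate restricted to `N_f ∈ {2,3}`, so a
  closure of 8840 by name closes it): proper-rotation invariance on `⁰𝒮` of the limits of the lattice `n`-point functions;
* the composition `StableActionBridge_of` is the PROVED soft OS closure `qcdOf_of_package` (section `SoftClosure` below,
  sorry-free: limit functionals on `⁰𝒮` by Hahn–Banach, inheritance of E0/E0′/E1-translations/E2/E3/E4 along asymptotic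
  lattice properties, `OSData.ofAxioms`, `IsQCDAlong`, the continuum gap by the tree's
  `IsQCDAlong.hasMassGap_of_hasSpeciesCSClustering`, non-triviality / non-Gaussianity by limit lower bounds) applied to the two
  stubs — it concludes the crux BY NAME.

Support files (all landed `--supports stmt-QuantumFields-9737`, imported above): T0 `…Defs` (canonical `qcdLatticeDist`, tensor
agreement `qcdLatticeSchwinger_eq_qcdLatticeDist`), soft closure I `…SoftClosureLimit` (Hahn–Banach limit functionals, labelled inheritance),
II `…SoftClosureQCD` (`exists_osData_qcd_of_package`, `qcdOf_of_package`), IV `…SoftClosureCanonical` (`qcdOf_of_canonicalPackage`), and the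
wave-1 stubs `…StubPermExact` (`stub_permExact`), `…StubOffDiagonalTensorDensity` (`stub_offDiagonalTensorDensity`).

Honesty of the pieces.  Every clause of `LatticePackage` is a property that honest lattice QCD along an asymptotically
scaling, mass-scaling, chirally pinned regularisation is EXPECTED to have and that any construction (Balaban-type RG with
dynamical Wilson quarks + the Yang–Mills infrared) would deliver in this or a stronger form (Glimm–Jaffe §6.1 / OS II §4:
k-uniform E0′ bounds + convergence; exact lattice symmetries ⇒ the asymptotic ones; Lüscher's positive transfer matrix with a
gap ⇒ the OS forms are positive up to the `(−1)^F`-boundary defect of the time-periodic torus functional, which vanishes as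
`a_k L_k → ∞`, and ⇒ Cauchy–Schwarz species clustering — by `MassGapToLatticeClustering` the latter is EQUIVALENT to the
continuum gap clause given convergence).  It is NOT the summit reworded: `QCDOf` does not give the k-uniform bounds, the
convergence off tensors, or any lattice symmetry, and `LatticePackage` gives no OS data and no E1.  What remains open is
visible: the two stubs.  Possible strengthenings (next leads; each a provable-now lattice theorem that moves a clause of
`LatticePackage` from "assumed asymptotically" to "proved exactly at finite k"): the canonical `qcdLatticeDist` with
`latticeSchwinger_eq` (tensor agreement), exact permutation symmetry (even Grassmann insertions commute), exact hermiticity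
(tree `QCDTimeReflection`), lattice-vector translation covariance (tree `QCDTorusTranslation`) + equicontinuity
(`translate_eq_of_labelled_tendsto_of_approx`), and density of off-diagonal real tensors in `⁰𝒮`.

History of the composition: cycles 1–4 `qcd_of_thresholdQCD ∘ stub_formatAP`; cycle 5 re-cut after the re-type p117723;
cycles 8–16 the planner's item split {8794, 17394} (glue p131993, `crux_iff_stubs` kept below as `crux_iff_items`); cycle 16b
(this file) the lattice/continuum re-cut with proved closure.  The ≈ 150 helper files of cycles 1–7 (Lüscher transfer-matrix
formalism for the statement's functional, positivity of `T̂_F` and of the Wilson gauge kernel, supertrace / thermal-trace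
forms of the torus denominators, the finite-dimensional Goldstone chain behind `IsChiralAtZero`) stay attached as
`--supports` and are inputs for whoever attacks `stub_latticeQCD` (its clauses P8 eventual RP and P10 clustering/gap are
exactly where those capstones bite).

Disproof used: none exists for this crux (`ledger crux ls`: no Disproof.lean; `dead_lines = []`).
-/

noncomputable section

open Filter Topology ComplexConjugate
open scoped SchwartzMap InnerProductSpace ComplexOrder
open Literature.MathematicalPhysics.AQFT Literature.MathematicalPhysics.QuantumLattice
open Literature.MathematicalPhysics.QuantumFieldTheory
open Summit.QuantumFields.QCD.Theses.QuarksAsStableAction (UnquenchedChessboardBound WilsonQuarkStability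
  StableActionBridge StableActionBridgeOfSplit ChiralCompletion ThresholdQCD)

namespace Summit.QuantumFields.QCD.Cruxes.StableActionBridge.Sketch

local notation "E4" => EuclideanSpace ℝ (Fin 4)

/-! ## Strengthenings of the r3c package (reshape r3d, lead c16) -/

/-! ### Landed in wave 1 (imported; formerly `sorry` stubs of this skeleton)

* `stub_permExact : ∀ {Nf} (sch : QCDScheme Nf) (k n : ℕ) (σ : Fin n → QCDField Nf) (π : Equiv.Perm (Fin n))
    (F : 𝓢((Fin n → E4), ℂ)), qcdLatticeDist sch k n σ (permTest π F) = qcdLatticeDist sch k n (σ ∘ π) F`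
  — `Theorems/QuarksAsStableActionStableActionBridgeStubPermExact.lean` (p141413): insertions are central Grassmann elements,
  the ordered product is permutation invariant, the site sum is reindexed; OS E3 EXACTLY at finite `k`.
* `stub_offDiagonalTensorDensity : ∀ (n : ℕ) (F : 𝓢((Fin n → E4), ℂ)), IsOffDiagonal F →
    F ∈ closure (span ℂ {G | G ∈ tensorProducts n ∧ IsOffDiagonal G})`
  — `Theorems/QuarksAsStableActionStableActionBridgeStubOffDiagonalTensorDensity.lean` (p141569): separated compact cutoffs,
  lattice-bump partition, box Fourier-series density over pairwise disjoint blocks; the `⁰𝒮` form of `𝒮(ℝ^{4n}) = ⊗̂ⁿ𝒮(ℝ⁴)`. -/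

/-! ## Proved reduction: convergence on `⁰𝒮` from convergence on off-diagonal real tensors (ε/3) -/

/-- **ε/3-reduction.**  Let `u k` be continuous linear functionals on `𝓢((ℝ⁴)ⁿ, ℂ)` that are EVENTUALLY uniformly bounded
on `⁰𝒮` by a multiple of one Schwartz norm `|·|_M`, whose values converge on every off-diagonal real tensor product, and
assume off-diagonal real tensor products are total in `⁰𝒮`.  Then `u k F` converges for every `F ∈ ⁰𝒮`: the span consists of
off-diagonal functions on which `u k` converges (linearity); for `F ∈ ⁰𝒮` pick `G` in the span with `|F − G|_M` small
(`|·|_M` is continuous on `𝓢`), so `u k F` is Cauchy. [cite: ReedSimonI1980, Thm I.2 (BLT) / §V.3] -/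
theorem tendsto_offDiagonal_of_tensor {n : ℕ} (u : ℕ → 𝓢((Fin n → E4), ℂ) →L[ℂ] ℂ) {C : ℝ} {M : ℕ}
    (hb : ∀ᶠ k in atTop, ∀ F : 𝓢((Fin n → E4), ℂ), IsOffDiagonal F → ‖u k F‖ ≤ C * schwartzNorm M F)
    (hdense : ∀ F : 𝓢((Fin n → E4), ℂ), IsOffDiagonal F →
      F ∈ closure ((Submodule.span ℂ {G : 𝓢((Fin n → E4), ℂ) | G ∈ tensorProducts n ∧ IsOffDiagonal G} :
        Submodule ℂ 𝓢((Fin n → E4), ℂ)) : Set 𝓢((Fin n → E4), ℂ)))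
    (hconv : ∀ F : 𝓢((Fin n → E4), ℂ), F ∈ tensorProducts n → IsOffDiagonal F →
      ∃ c : ℂ, Tendsto (fun k => u k F) atTop (𝓝 c))
    (F : 𝓢((Fin n → E4), ℂ)) (hF : IsOffDiagonal F) : ∃ c : ℂ, Tendsto (fun k => u k F) atTop (𝓝 c) := by
  classical
  -- (1) the span consists of off-diagonal functions on which `u k` converges
  have hspan : ∀ G ∈ (Submodule.span ℂ {G : 𝓢((Fin n → E4), ℂ) | G ∈ tensorProducts n ∧ IsOffDiagonal G} :
      Submodule ℂ 𝓢((Fin n → E4), ℂ)), IsOffDiagonal G ∧ ∃ c : ℂ, Tendsto (fun k => u k G) atTop (𝓝 c) := by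
    intro G hG
    refine Submodule.span_induction ?_ ?_ ?_ ?_ hG
    · rintro G ⟨hGt, hGo⟩
      exact ⟨hGo, hconv G hGt hGo⟩
    · exact ⟨isOffDiagonal_zero, 0, by simpa only [map_zero] using tendsto_const_nhds⟩
    · rintro G G' - - ⟨hGo, c, hc⟩ ⟨hG'o, c', hc'⟩
      exact ⟨hGo.add hG'o, c + c', by simpa only [map_add] using hc.add hc'⟩
    · rintro a G - ⟨hGo, c, hc⟩
      exact ⟨hGo.smul a, a • c, by simpa only [map_smul] using hc.const_smul a⟩
  -- (2) `u k F` is Cauchy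
  have hCauchy : CauchySeq fun k => u k F := by
    rw [Metric.cauchySeq_iff]
    intro ε hε
    set C' : ℝ := |C| + 1 with hC'def
    have hC' : 0 < C' := by positivity
    set δ : ℝ := ε / (4 * C') with hδdef
    have hδ : 0 < δ := by positivity
    have hC'δ : C' * δ = ε / 4 := by
      rw [hδdef]
      field_simp
    -- a `G` in the span with `|F - G|_M < δ`
    have hqc : Continuous fun G : 𝓢((Fin n → E4), ℂ) => schwartzNorm M G :=
      Seminorm.continuous_finsetSup (s := Finset.Iic (M, M)) fun i _ =>
        (schwartz_withSeminorms ℂ (Fin n → E4) ℂ).continuous_seminorm i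
    have hcont : Continuous fun G : 𝓢((Fin n → E4), ℂ) => schwartzNorm M (F - G) :=
      hqc.comp (continuous_const.sub continuous_id)
    have hnhds : {G : 𝓢((Fin n → E4), ℂ) | schwartzNorm M (F - G) < δ} ∈ 𝓝 F := by
      refine (isOpen_lt hcont continuous_const).mem_nhds ?_
      show schwartzNorm M (F - F) < δ
      have h0 : schwartzNorm M (0 : 𝓢((Fin n → E4), ℂ)) = 0 := map_zero _
      rw [sub_self, h0]
      exact hδ
    obtain ⟨G, hGδ, hGV⟩ := mem_closure_iff_nhds.1 (hdense F hF) _ hnhds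
    obtain ⟨hGo, c, hc⟩ := hspan G hGV
    have hcG := hc.cauchySeq
    rw [Metric.cauchySeq_iff] at hcG
    obtain ⟨N₁, hN₁⟩ := hcG (ε / 4) (by positivity)
    obtain ⟨N₂, hN₂⟩ := eventually_atTop.1 hb
    refine ⟨max N₁ N₂, fun j hj k hk => ?_⟩
    have hFG : IsOffDiagonal (F - G) := hF.sub hGo
    have hsn : 0 ≤ schwartzNorm M (F - G) := apply_nonneg _ _
    have hest : ∀ l, N₂ ≤ l → ‖u l (F - G)‖ ≤ ε / 4 := by
      intro l hl
      calc ‖u l (F - G)‖ ≤ C * schwartzNorm M (F - G) := hN₂ l hl _ hFG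
        _ ≤ |C| * schwartzNorm M (F - G) := by gcongr; exact le_abs_self C
        _ ≤ C' * schwartzNorm M (F - G) := by gcongr; simp [hC'def]
        _ ≤ C' * δ := by gcongr; exact le_of_lt hGδ
        _ = ε / 4 := hC'δ
    have hj₂ := hest j (le_of_max_le_right hj)
    have hk₂ := hest k (le_of_max_le_right hk)
    have hjk := hN₁ j (le_of_max_le_left hj) k (le_of_max_le_left hk)
    rw [dist_eq_norm] at hjk ⊢
    have hsplit : u j F - u k F = (u j (F - G) - u k (F - G)) + (u j G - u k G) := by
      simp only [map_sub]
      abel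
    calc ‖u j F - u k F‖ = ‖(u j (F - G) - u k (F - G)) + (u j G - u k G)‖ := by rw [hsplit]
      _ ≤ ‖u j (F - G) - u k (F - G)‖ + ‖u j G - u k G‖ := norm_add_le _ _
      _ ≤ (‖u j (F - G)‖ + ‖u k (F - G)‖) + ‖u j G - u k G‖ := by gcongr; exact norm_sub_le _ _
      _ ≤ (ε / 4 + ε / 4) + ‖u j G - u k G‖ := by gcongr
      _ < (ε / 4 + ε / 4) + ε / 4 := by gcongr
      _ < ε := by linarith
  exact cauchySeq_tendsto_of_complete hCauchy

/-- **P3 of the r3c package from P2 + P3′ (convergence of the honest lattice `n`-point functions on off-diagonal real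
tensors) + the density stub.**  Degree `0` is point evaluation (constant in `k`); in degree `n ≥ 1` the canonical
distribution IS `qcdLatticeSchwinger` on real tensors (`qcdLatticeSchwinger_eq_qcdLatticeDist`), and
`tendsto_offDiagonal_of_tensor` applies with the k-uniform E0′ bound. [cite: OsterwalderSchraderCMP1975, §4] -/
theorem tendsto_qcdLatticeDist_of_tensor {Nf : ℕ} (sch : QCDScheme Nf)
    (hdense : ∀ (n : ℕ) (F : 𝓢((Fin n → E4), ℂ)), IsOffDiagonal F →
      F ∈ closure ((Submodule.span ℂ {G : 𝓢((Fin n → E4), ℂ) | G ∈ tensorProducts n ∧ IsOffDiagonal G} :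
        Submodule ℂ 𝓢((Fin n → E4), ℂ)) : Set 𝓢((Fin n → E4), ℂ)))
    {s : ℕ} {α β : ℝ}
    (hbound : ∀ (n : ℕ) (σ : Fin n → QCDField Nf), ∀ᶠ k in atTop, ∀ F : 𝓢((Fin n → E4), ℂ), IsOffDiagonal F →
      ‖qcdLatticeDist sch k n σ F‖ ≤ α * (n.factorial : ℝ) ^ β * schwartzNorm (n * s) F)
    (hconv : ∀ n : ℕ, n ≠ 0 → ∀ (σ : Fin n → QCDField Nf) (f : Fin n → 𝓢(E4, ℝ)) (F : 𝓢((Fin n → E4), ℂ)),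
      IsTensorOf F (fun i => ofRealTest (f i)) → IsOffDiagonal F →
      ∃ c : ℂ, Tendsto (fun k => qcdLatticeSchwinger sch k n σ f) atTop (𝓝 c)) :
    ∀ (n : ℕ) (σ : Fin n → QCDField Nf) (F : 𝓢((Fin n → E4), ℂ)), IsOffDiagonal F →
      ∃ c : ℂ, Tendsto (fun k => qcdLatticeDist sch k n σ F) atTop (𝓝 c) := by
  intro n σ F hF
  rcases Nat.eq_zero_or_pos n with rfl | hn
  · exact ⟨F default, by simpa only [qcdLatticeDist_zero_apply] using tendsto_const_nhds⟩
  · refine tendsto_offDiagonal_of_tensor (fun k => qcdLatticeDist sch k n σ) (hbound n σ) (hdense n) ?_ F hF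
    rintro G ⟨f, hGf⟩ hGo
    obtain ⟨c, hc⟩ := hconv n hn.ne' σ f G hGf hGo
    exact ⟨c, hc.congr' (Eventually.of_forall fun k =>
      (qcdLatticeSchwinger_eq_qcdLatticeDist sch k n hn.ne' σ f G hGf).symm)⟩

/-! ## The two honest pieces of the reshaped line -/

/-- **The lattice-side package of `N_f`-flavour Wilson lattice QCD** (the statement of `stub_latticeQCD`; open problem; r3d).
ONE mass-independent regularisation `reg` (spacings `a_k → 0`, two-loop couplings, volumes, flavour-blind `m_crit(k)`,
`Z_m(k)`) with leading-log `HasMassScaling` and `IsChiralAtZero`, such that for EVERY positive renormalised mass tuple `m`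
there are species renormalisations `z, shift` such that, for the scheme `sch = reg.scheme m z shift` and its CANONICAL lattice
`n`-point DISTRIBUTIONS `qcdLatticeDist sch k n σ` (T0, landed Defs file; `= qcdLatticeSchwinger` on real tensors, `= δ_pt` in degree 0):
(P1) two-loop asymptotic scaling of `β_k` and bare masses eventually on the physical branch `m_f(k) > −1`;
(P2) a k-uniform E0′ bound `‖qcdLatticeDist sch k n σ F‖ ≤ α (n!)^β |F|_{ns}` on `⁰𝒮` (OS II §2; UV stability in ratio form);
(P3′) — r3d: convergence of the honest lattice `n`-point functions `qcdLatticeSchwinger sch k n σ f` along the FULL sequence on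
every off-diagonal REAL TENSOR `⊗ᵢ fᵢ ∈ ⁰𝒮` (literally the convergence datum of the statement's `IsQCDAlong`; convergence on all
of `⁰𝒮` follows by `tendsto_qcdLatticeDist_of_tensor` from P2 and the density stub);
(P4, P5, P7) — THEOREMS / dropped: normalisation (`qcdLatticeDist_zero_apply`), hermiticity (from P4 + P8,
`isHermitian_of_isReflectionPositive`), permutation symmetry (exact at finite `k`, `stub_permExact`);
(P6) asymptotic invariance under every translation of `ℝ⁴` on `⁰𝒮` (lattice-vector covariance of the torus moments is exact;
the boundary relabelling defect is what is asserted to vanish — it needs the package's own bounds, hence stays a clause);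
(P8) EVENTUAL APPROXIMATE reflection positivity of the OS forms `Σᵢⱼ qcdLatticeDist sch k (ΘFᵢ* ⊗ Fⱼ)` (`re ≥ −ε`, `|im| ≤ ε`
eventually, every `ε > 0`): Lüscher positivity of the Wilson transfer matrix makes the thermal (time-antiperiodic) forms
exactly positive; the statement's time-PERIODIC torus functional differs by the `(−1)^F` boundary term, which vanishes as
`a_k(2L_k+1) → ∞` in a gapped theory (line `twisted_trace_transfer`: `CorrelatorReturn` / `SchwingerReturn`);
(P9) k-uniform SPATIAL clustering of the truncated functions of time-ordered tensors (E4, no rate);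
(P10) ONE rate `Δ > 0` with species Cauchy–Schwarz clustering `sch.HasSpeciesCSClustering Δ` (the lattice form of the
continuum gap clause, tree `MassGapFromLatticeClustering` / `…ToLatticeClustering`) AND the uniform lattice gap
`sch.HasLatticeMassGap Δ` of the statement;
(P11) eventual lower bounds `ε > 0` on the norms of the truncated two-point functions of `glue` and of every
flavour-changing `pseudoRe f g`, and of the connected three-point function `κ₃` of `glue`, on some time-ordered /
off-diagonal tensors (non-triviality, dynamical quarks, non-Gaussianity at the lattice level, uniformly in `k`).
Nothing here mentions OS data or rotations. [difficulty: open-problem] -/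
def LatticePackage (Nf : ℕ) : Prop :=
  ∃ reg : QCDRegularisation Nf, reg.HasMassScaling ∧ reg.IsChiralAtZero ∧
      ∀ m : Fin Nf → ℝ, (∀ f, 0 < m f) → ∃ (z shift : QCDField Nf → ℕ → ℝ),
        (reg.scheme m z shift).HasAsymptoticScaling ∧
        (∀ fl : Fin Nf, ∀ᶠ k in atTop, -1 < (reg.scheme m z shift).mq fl k) ∧
        (∃ (s : ℕ) (α β : ℝ), 0 ≤ α ∧ ∀ (n : ℕ) (σ : Fin n → QCDField Nf), ∀ᶠ k in atTop,
          ∀ F : 𝓢((Fin n → E4), ℂ), IsOffDiagonal F →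
            ‖qcdLatticeDist (reg.scheme m z shift) k n σ F‖ ≤ α * (n.factorial : ℝ) ^ β * schwartzNorm (n * s) F) ∧
        (∀ n : ℕ, n ≠ 0 → ∀ (σ : Fin n → QCDField Nf) (f : Fin n → 𝓢(E4, ℝ)) (F : 𝓢((Fin n → E4), ℂ)),
          IsTensorOf F (fun i => ofRealTest (f i)) → IsOffDiagonal F →
          ∃ c : ℂ, Tendsto (fun k => qcdLatticeSchwinger (reg.scheme m z shift) k n σ f) atTop (𝓝 c)) ∧
        (∀ (n : ℕ) (σ : Fin n → QCDField Nf) (a : E4) (F : 𝓢((Fin n → E4), ℂ)), IsOffDiagonal F →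
          Tendsto (fun k => qcdLatticeDist (reg.scheme m z shift) k n σ (translateMulti a F) -
            qcdLatticeDist (reg.scheme m z shift) k n σ F) atTop (𝓝 0)) ∧
        (∀ (N : ℕ) (deg : Fin N → ℕ) (lab : (j : Fin N) → Fin (deg j) → QCDField Nf)
          (F : (j : Fin N) → 𝓢((Fin (deg j) → E4), ℂ)), (∀ j, IsTimeOrdered (F j)) →
          ∀ H : (i j : Fin N) → 𝓢((Fin (deg i + deg j) → E4), ℂ),
            (∀ i j, IsAppendTensorOf (H i j) (osAdjoint (F i)) (F j)) →
            ∀ ε : ℝ, 0 < ε → ∀ᶠ l in atTop,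
              -ε ≤ (∑ i, ∑ j, qcdLatticeDist (reg.scheme m z shift) l (deg i + deg j)
                (Fin.append (lab i ∘ Fin.rev) (lab j)) (H i j)).re ∧
              |(∑ i, ∑ j, qcdLatticeDist (reg.scheme m z shift) l (deg i + deg j)
                (Fin.append (lab i ∘ Fin.rev) (lab j)) (H i j)).im| ≤ ε) ∧
        (∀ (n n' : ℕ) (σ : Fin n → QCDField Nf) (σ' : Fin n' → QCDField Nf) (F : 𝓢((Fin n → E4), ℂ))
          (G : 𝓢((Fin n' → E4), ℂ)), IsTimeOrdered F → IsTimeOrdered G → ∀ a : E4, a 0 = 0 → a ≠ 0 →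
          ∀ ε : ℝ, 0 < ε → ∃ t₀ : ℝ, ∀ t : ℝ, t₀ ≤ t → ∀ H : 𝓢((Fin (n + n') → E4), ℂ),
            IsAppendTensorOf H (osAdjoint F) (translateMulti (t • a) G) →
            ∀ᶠ k in atTop, ‖qcdLatticeDist (reg.scheme m z shift) k (n + n') (Fin.append (σ ∘ Fin.rev) σ') H -
              qcdLatticeDist (reg.scheme m z shift) k n (σ ∘ Fin.rev) (osAdjoint F) *
                qcdLatticeDist (reg.scheme m z shift) k n' σ' G‖ ≤ ε) ∧
        (∃ Δ : ℝ, 0 < Δ ∧ (reg.scheme m z shift).HasSpeciesCSClustering Δ ∧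
          (reg.scheme m z shift).HasLatticeMassGap Δ) ∧
        (∃ (F G : 𝓢((Fin 1 → E4), ℂ)) (H : 𝓢((Fin (1 + 1) → E4), ℂ)),
          IsTimeOrdered F ∧ IsTimeOrdered G ∧ IsAppendTensorOf H (osAdjoint F) G ∧ ∃ ε : ℝ, 0 < ε ∧
            ∀ᶠ k in atTop, ε ≤ ‖qcdLatticeDist (reg.scheme m z shift) k (1 + 1) (fun _ => QCDField.glue) H -
              qcdLatticeDist (reg.scheme m z shift) k 1 (fun _ => QCDField.glue) (osAdjoint F) *
                qcdLatticeDist (reg.scheme m z shift) k 1 (fun _ => QCDField.glue) G‖) ∧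
        (∀ f g : Fin Nf, f ≠ g → ∃ (F G : 𝓢((Fin 1 → E4), ℂ)) (H : 𝓢((Fin (1 + 1) → E4), ℂ)),
          IsTimeOrdered F ∧ IsTimeOrdered G ∧ IsAppendTensorOf H (osAdjoint F) G ∧ ∃ ε : ℝ, 0 < ε ∧
            ∀ᶠ k in atTop, ε ≤ ‖qcdLatticeDist (reg.scheme m z shift) k (1 + 1) (fun _ => QCDField.pseudoRe f g) H -
              qcdLatticeDist (reg.scheme m z shift) k 1 (fun _ => QCDField.pseudoRe f g) (osAdjoint F) *
                qcdLatticeDist (reg.scheme m z shift) k 1 (fun _ => QCDField.pseudoRe f g) G‖) ∧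
        (∃ (f g h : 𝓢(E4, ℂ)) (Ffgh : 𝓢((Fin 3 → E4), ℂ)) (Fgh Ffh Ffg : 𝓢((Fin 2 → E4), ℂ))
          (Ff Fg Fh : 𝓢((Fin 1 → E4), ℂ)),
          IsTensorOf Ffgh ![f, g, h] ∧ IsOffDiagonal Ffgh ∧ IsTensorOf Fgh ![g, h] ∧ IsTensorOf Ffh ![f, h] ∧
          IsTensorOf Ffg ![f, g] ∧ IsOffDiagonal Fgh ∧ IsOffDiagonal Ffh ∧ IsOffDiagonal Ffg ∧
          IsTensorOf Ff ![f] ∧ IsTensorOf Fg ![g] ∧ IsTensorOf Fh ![h] ∧ ∃ ε : ℝ, 0 < ε ∧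
            ∀ᶠ k in atTop, ε ≤ ‖qcdLatticeDist (reg.scheme m z shift) k 3 (fun _ => QCDField.glue) Ffgh
              - qcdLatticeDist (reg.scheme m z shift) k 1 (fun _ => QCDField.glue) Ff *
                  qcdLatticeDist (reg.scheme m z shift) k 2 (fun _ => QCDField.glue) Fgh
              - qcdLatticeDist (reg.scheme m z shift) k 1 (fun _ => QCDField.glue) Fg *
                  qcdLatticeDist (reg.scheme m z shift) k 2 (fun _ => QCDField.glue) Ffh
              - qcdLatticeDist (reg.scheme m z shift) k 1 (fun _ => QCDField.glue) Fh *
                  qcdLatticeDist (reg.scheme m z shift) k 2 (fun _ => QCDField.glue) Ffg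
              + 2 * (qcdLatticeDist (reg.scheme m z shift) k 1 (fun _ => QCDField.glue) Ff *
                  qcdLatticeDist (reg.scheme m z shift) k 1 (fun _ => QCDField.glue) Fg *
                  qcdLatticeDist (reg.scheme m z shift) k 1 (fun _ => QCDField.glue) Fh)‖)

/-- **The E1 (rotation) module for `N_f` flavours** (the statement of `stub_rotation`; open problem — there is no
non-perturbative `O(4)`-restoration theorem in `d = 4`): for every lattice-QCD scheme with two-loop asymptotic scaling, bare
masses eventually on the physical branch and a uniform lattice gap, every labelled Schwinger family that is the `k → ∞` limit of
the honest lattice `n`-point functions on off-diagonal real tensors is invariant under proper rotations on `⁰𝒮`.  This is item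
stmt-QuantumFields-8840 `RotationRestoration` (FourMirrorsWardE1 / DiagonalSpine / GapBuysCauchyRate) at the flavour number `Nf`;
the line uses it only at `N_f ∈ {2, 3}`. [difficulty: open-problem] -/
def RotationModule (Nf : ℕ) : Prop :=
  ∀ sch : QCDScheme Nf, sch.HasAsymptoticScaling →
      (∀ fl : Fin Nf, ∀ᶠ k in atTop, -1 < sch.mq fl k) → (∃ Δ : ℝ, 0 < Δ ∧ sch.HasLatticeMassGap Δ) →
      ∀ S : LabelledSchwingerFamily (QCDField Nf) E4,
        (∀ n : ℕ, n ≠ 0 → ∀ (σ : Fin n → QCDField Nf) (f : Fin n → 𝓢(E4, ℝ)) (F : 𝓢((Fin n → E4), ℂ)),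
          IsTensorOf F (fun i => ofRealTest (f i)) → IsOffDiagonal F →
          Tendsto (fun k => qcdLatticeSchwinger sch k n σ f) atTop (𝓝 (S n σ F))) →
        ∀ (n : ℕ) (σ : Fin n → QCDField Nf) (R : E4 ≃ₗᵢ[ℝ] E4),
          LinearMap.det (R.toLinearEquiv : E4 →ₗ[ℝ] E4) = 1 →
          ∀ F : 𝓢((Fin n → E4), ℂ), IsOffDiagonal F → S n σ (linActMulti R F) = S n σ F

/-- **Stub (open, the lead's): the lattice-side package for `N_f = 2` and `N_f = 3`.**  See `LatticePackage`. -/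
theorem stub_latticeQCD : ∀ Nf : ℕ, Nf = 2 ∨ Nf = 3 → LatticePackage Nf := by
  sorry

/-- **Stub (open): the E1 module for `N_f = 2` and `N_f = 3`.**  See `RotationModule`; implied by item 8840. -/
theorem stub_rotation : ∀ Nf : ℕ, Nf = 2 ∨ Nf = 3 → RotationModule Nf := by
  sorry

/-! ## Dockings (proved) -/

/-- Item 8840 `RotationRestoration` (rendered in three route files with the same text, quantified over ALL `Nf`) gives the
rotation module at every `Nf`; recorded as the statement-level implication so that a closure of 8840 by name feeds
`stub_rotation` (`fun h Nf _ => h Nf`). [folklore] -/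
theorem rotationModule_of_all (h : ∀ Nf : ℕ, RotationModule Nf) : ∀ Nf : ℕ, Nf = 2 ∨ Nf = 3 → RotationModule Nf :=
  fun Nf _ => h Nf

/-- **The crux is literally the conjunct**: both hypotheses of the bridge are theorems of the tree (A = item 9735,
`UnquenchedChessboardBound_of`; S = item 9736, `WilsonQuarkStability_of`), so `StableActionBridge ↔ QCD`. [folklore] -/
theorem stableActionBridge_iff_qcd : StableActionBridge ↔ _root_.QCD :=
  ⟨fun h => h Summit.QuantumFields.QCD.Theorems.UnquenchedChessboardBoundLine.UnquenchedChessboardBound_of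
      Summit.QuantumFields.QCD.Cruxes.WilsonQuarkStability.FreeTangentLandauChessboard.WilsonQuarkStability_of,
    fun h _ _ => h⟩

/-- The cycle-8 item split is lossless and stays available: `StableActionBridge ↔ (ThresholdQCD ∧ ChiralCompletion)`
(items 8794 ∧ 17394; glue p131993).  Kept so that a closure of those items still closes the crux. [folklore] -/
theorem crux_iff_items : StableActionBridge ↔ (ThresholdQCD ∧ ChiralCompletion) := by
  refine ⟨fun h => ⟨?_, ?_⟩, fun h _ _ => ⟨h.2 2 (Or.inl rfl) (h.1 2 (Or.inl rfl)), h.2 3 (Or.inr rfl) (h.1 3 (Or.inr rfl))⟩⟩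
  · have hq : _root_.QCD := stableActionBridge_iff_qcd.1 h
    intro Nf hNf
    rcases hNf with rfl | rfl
    · obtain ⟨reg, hMS, -, hall⟩ := hq.1
      exact ⟨0, le_rfl, reg, hMS, hall⟩
    · obtain ⟨reg, hMS, -, hall⟩ := hq.2
      exact ⟨0, le_rfl, reg, hMS, hall⟩
  · have hq : _root_.QCD := stableActionBridge_iff_qcd.1 h
    intro Nf hNf _
    rcases hNf with rfl | rfl
    · exact hq.1
    · exact hq.2

/-! ## The composition -/

/-- `QCDOf N_f` for `N_f ∈ {2,3}` from the four stubs: the r3d package is expanded to the r3c hypotheses of the proved soft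
closure `qcdOf_of_canonicalPackage` — P3 by `tendsto_qcdLatticeDist_of_tensor` (P2 + P3′ + `stub_offDiagonalTensorDensity`),
P7 identically by `stub_permExact` — and the rotation module is `stub_rotation`. -/
theorem qcdOf_of_stubs (Nf : ℕ) (hNf : Nf = 2 ∨ Nf = 3) : QCDOf Nf := by
  obtain ⟨reg, hms, hχ, hall⟩ := stub_latticeQCD Nf hNf
  refine qcdOf_of_canonicalPackage ⟨reg, hms, hχ, fun m hm => ?_⟩ (stub_rotation Nf hNf)
  obtain ⟨z, shift, hAS, hbr, ⟨s, α, β, hα, hb⟩, hconv, htrans, hrp, hcl, hgap, hglue, hpseudo, hκ₃⟩ := hall m hm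
  refine ⟨z, shift, hAS, hbr, ⟨s, α, β, hα, hb⟩, ?_, htrans, ?_, hrp, hcl, hgap, hglue, hpseudo, hκ₃⟩
  · exact tendsto_qcdLatticeDist_of_tensor (reg.scheme m z shift) stub_offDiagonalTensorDensity hb hconv
  · intro n σ π F _
    have h0 : (fun k => qcdLatticeDist (reg.scheme m z shift) k n σ (permTest π F) -
        qcdLatticeDist (reg.scheme m z shift) k n (σ ∘ π) F) = fun _ => 0 :=
      funext fun k => by rw [stub_permExact, sub_self]
    rw [h0]
    exact tendsto_const_nhds

/-- **The composition**: the registered stubs imply the crux `QuarksAsStableAction.StableActionBridge`, concluded BY NAME: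
the bridge hypotheses A, S are discarded (they are theorems) and `QCD = QCDOf 2 ∧ QCDOf 3` is the proved soft OS closure of the
lattice package and the rotation module at `N_f = 2, 3`. -/
theorem StableActionBridge_of : StableActionBridge :=
  fun _ _ => ⟨qcdOf_of_stubs 2 (Or.inl rfl), qcdOf_of_stubs 3 (Or.inr rfl)⟩

end Summit.QuantumFields.QCD.Cruxes.StableActionBridge.Sketch

end
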